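import Summits.CriticalPhenomena.PercolationContinuityZ3.Theorems.PercNearOneGluingNoHeavyLowerTailSahiThreeCopyCellCert

/-!
# `NoHeavyLowerTail` (crux stmt-CriticalPhenomena-4575), Sahi programme: **CELL CERTIFICATES I — point codes and the integer mirrors
# of the `θ`-free forms `cK`, `B`** (the third copy of an arrangement is determined by the other two)

Support file (Sahi cell, seat `prim-sahi-p1`, generation 65; `--supports stmt-CriticalPhenomena-4575`); companion of `…SahiThreeCopyCellCert`
(gen 64: `cKcoef`, `Bcoef`, `nArr1`), `…SahiThreeCopyTwoPointRefutation` (gen 60: `zOf`, `eq_zOf_of_isArr`, `sum_arrInd_collapse`).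
Definitions + lemmas only, no evaluation; no `sorry`, standard axioms.  Part I of the verified checker for the exact piecewise-TP₀ CELL
CERTIFICATES of memo FROM-prim-sahi-p1-gen64 §7–§10 (C₈ at `1⁸`, F₇ at `1⁷`); parts II/III: `…CellAccum` (generators, array accumulation),
`…CellCheck` (the checker `checkCell` and its soundness).

CONTENT.  §1 `ptOfCode k n` (bit `i` of `n` is coordinate `i`), `codeOf k e = Σ e_i 2^i` with the round trips `ptOfCode_codeOf`, `codeOf_ptOfCode`
(`n < 2^k`), `codeOf_lt`, and `ptOfCode_le_of_lor` (`a ||| b = b ⇒ ↑a ≤ ↑b`).  §2 INTEGER MIRRORS for an integer-valued slot `fZ`: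
`cKZ π fZ e = Σ_y ([arr(e,y,·)]·2fZ(e) − [arr(y,e,·)]·fZ(y))` and `BZ π fZ e e′ = [arr(z,e,e′)]fZ(z) − [arr(e,e′,z)](fZ e′ + fZ e)` with
`z = zOf π e e′` — ★ `cKcoef_eq_cKZ`, ★ `Bcoef_eq_BZ`, `nArr1_eq_nArr1Z` (the `2^{3k}`-term defining sums collapse to `2^k` / `O(1)` terms because
two copies of an arrangement determine the third, `sum_arrInd_pin1/2/12/23`). [this work]
-/

namespace Summit.CriticalPhenomena.PercolationContinuityZ3.Theorems.SahiThreeCopy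

open Finset Function Literature.Combinatorics.Sahi2008
open scoped BigOperators

variable {k : ℕ}

/-! ### §1 Point codes -/

/-- The level with binary code `n`: coordinate `i` is bit `i` of `n`. [this work] -/
def ptOfCode (k : ℕ) (n : ℕ) : Pt k := fun i => n.testBit i.val

/-- The binary code `Σ_i e_i 2^i` of a level (recursive form). [this work] -/
def codeOf : (k : ℕ) → Pt k → ℕ
  | 0, _ => 0
  | k + 1, e => (e 0).toNat + 2 * codeOf k (Fin.tail e)

/-- `codeOf e < 2^k`. [this work] -/
theorem codeOf_lt : ∀ (k : ℕ) (e : Pt k), codeOf k e < 2 ^ k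
  | 0, _ => by simp [codeOf]
  | k + 1, e => by
    have ih := codeOf_lt k (Fin.tail e)
    simp only [codeOf, pow_succ]
    cases e 0 <;> simp <;> omega

/-- Decoding the code of a level gives the level back. [this work] -/
theorem ptOfCode_codeOf : ∀ (k : ℕ) (e : Pt k), ptOfCode k (codeOf k e) = e
  | 0, e => funext fun i => i.elim0
  | k + 1, e => by
    have ih := ptOfCode_codeOf k (Fin.tail e)
    funext i
    refine Fin.cases ?_ (fun j => ?_) i
    · simp only [ptOfCode, Fin.val_zero, Nat.testBit_zero, codeOf]
      cases e 0 <;> simp [Nat.add_mul_mod_self_left]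
    · have hj : ptOfCode k (codeOf k (Fin.tail e)) j = Fin.tail e j := by rw [ih]
      simp only [ptOfCode, Fin.tail] at hj
      simp only [ptOfCode, Fin.val_succ, Nat.testBit_succ, codeOf]
      have h2 : ((e 0).toNat + 2 * codeOf k (Fin.tail e)) / 2 = codeOf k (Fin.tail e) := by
        cases e 0 <;> simp only [Bool.toNat_false, Bool.toNat_true] <;> omega
      rw [h2]; exact hj

/-- Encoding the level of a code `< 2^k` gives the code back. [this work] -/
theorem codeOf_ptOfCode : ∀ (k : ℕ) (n : ℕ), n < 2 ^ k → codeOf k (ptOfCode k n) = n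
  | 0, n, hn => by simp [codeOf] at hn ⊢; omega
  | k + 1, n, hn => by
    have ih := codeOf_ptOfCode k (n / 2) (by rw [pow_succ] at hn; omega)
    have htail : Fin.tail (ptOfCode (k + 1) n) = ptOfCode k (n / 2) := by
      funext j; simp [Fin.tail, ptOfCode, Nat.testBit_succ]
    simp only [codeOf, htail, ih]
    simp only [ptOfCode, Fin.val_zero, Nat.testBit_zero]
    rcases Nat.mod_two_eq_zero_or_one n with h | h <;> simp [h] <;> omega

/-- `codeOf` is injective-on-codes: `codeOf e = n` iff `e = ptOfCode n` (for `n < 2^k`). [this work] -/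
theorem codeOf_eq_iff (k : ℕ) (e : Pt k) {n : ℕ} (hn : n < 2 ^ k) : codeOf k e = n ↔ e = ptOfCode k n := by
  constructor
  · intro h; rw [← h, ptOfCode_codeOf]
  · intro h; rw [h, codeOf_ptOfCode k n hn]

/-- If `a ||| b = b` then `ptOfCode a ≤ ptOfCode b` coordinatewise. [this work] -/
theorem ptOfCode_le_of_lor {a b : ℕ} (h : a ||| b = b) : ptOfCode k a ≤ ptOfCode k b := by
  intro i
  have := congrArg (fun n => Nat.testBit n i.val) h
  simp only [Nat.testBit_or] at this
  simp only [ptOfCode, ge_iff_le]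
  revert this; cases a.testBit i.val <;> cases b.testBit i.val <;> simp

/-! ### §2 Integer mirrors of `cK` and `B` (the third copy is determined) -/

/-- Rotating an arrangement. [this work] -/
theorem isArr_rotate {π : Fin k → ℕ} {x y z : Pt k} : IsArr π x y z ↔ IsArr π y z x := by
  unfold IsArr; exact forall_congr' fun i => by constructor <;> intro h <;> omega

/-- Swapping the first two copies of an arrangement. [this work] -/
theorem isArr_swap12 {π : Fin k → ℕ} {x y z : Pt k} : IsArr π x y z ↔ IsArr π y x z := by
  unfold IsArr; exact forall_congr' fun i => by constructor <;> intro h <;> omega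

/-- `zOf` is symmetric. [this work] -/
theorem zOf_comm (π : Fin k → ℕ) (x y : Pt k) : zOf π x y = zOf π y x := by
  funext i; simp only [zOf]; congr 1; exact propext ⟨fun h => by omega, fun h => by omega⟩

/-- Integer mirror of `cK(e) = Σ_arr [2f(e₁)[e₁ = e] − f(e₁)[e₂ = e]]` for an integer-valued slot: the sum over the SECOND copy only
(the third is determined). [this work] -/
def cKZ (π : Fin k → ℕ) (fZ : Pt k → ℤ) (e : Pt k) : ℤ :=
  ∑ y : Pt k, ((if IsArr π e y (zOf π e y) then 2 * fZ e else 0) - (if IsArr π y e (zOf π y e) then fZ y else 0))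

/-- Integer mirror of `B(e,e′) = Σ_arr [f(e₁)[e₂=e][e₃=e′] − f(e₂)[e₁=e][e₂=e′] − f(e₂)[e₂=e][e₁=e′]]`: `O(1)` per entry. [this work] -/
def BZ (π : Fin k → ℕ) (fZ : Pt k → ℤ) (e e' : Pt k) : ℤ :=
  (if IsArr π (zOf π e e') e e' then fZ (zOf π e e') else 0) - (if IsArr π e e' (zOf π e e') then fZ e' + fZ e else 0)

/-- Collapsing an arrangement sum in which copies 2 and 3 are pinned. [this work] -/
theorem sum_arrInd_pin23 (π : Fin k → ℕ) (g : Pt k → ℝ) (e e' : Pt k) :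
    ∑ σ : Pt k × Pt k × Pt k, arrInd π σ.1 σ.2.1 σ.2.2 * (g σ.1 * (if σ.2.1 = e ∧ σ.2.2 = e' then 1 else 0)) =
      if IsArr π (zOf π e e') e e' then g (zOf π e e') else 0 := by
  rw [Fintype.sum_prod_type]
  have inner : ∀ x : Pt k, ∑ yz : Pt k × Pt k, arrInd π x yz.1 yz.2 * (g x * (if yz.1 = e ∧ yz.2 = e' then 1 else 0)) =
      arrInd π x e e' * g x := by
    intro x
    rw [Finset.sum_eq_single (e, e')]
    · simp
    · rintro ⟨y, z⟩ _ hne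
      have : ¬ (y = e ∧ z = e') := fun h => hne (Prod.ext h.1 h.2)
      simp [this]
    · intro h; exact absurd (mem_univ _) h
  simp only [inner]
  rw [Finset.sum_eq_single (zOf π e e')]
  · simp only [arrInd]; split_ifs <;> simp
  · intro x _ hx
    have : ¬ IsArr π x e e' := fun h => hx (eq_zOf_of_isArr (isArr_rotate.1 h))
    simp [arrInd, this]
  · intro h; exact absurd (mem_univ _) h

/-- Collapsing an arrangement sum in which copies 1 and 2 are pinned. [this work] -/
theorem sum_arrInd_pin12 (π : Fin k → ℕ) (g : Pt k → Pt k → Pt k → ℝ) (e e' : Pt k) :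
    ∑ σ : Pt k × Pt k × Pt k, arrInd π σ.1 σ.2.1 σ.2.2 * (g σ.1 σ.2.1 σ.2.2 * (if σ.1 = e ∧ σ.2.1 = e' then 1 else 0)) =
      if IsArr π e e' (zOf π e e') then g e e' (zOf π e e') else 0 := by
  rw [sum_arrInd_collapse π (fun a b c => g a b c * (if a = e ∧ b = e' then 1 else 0))]
  rw [Finset.sum_eq_single e]
  · rw [Finset.sum_eq_single e']
    · simp only [arrInd, and_self, if_true, mul_one]; split_ifs <;> simp
    · intro y _ hy; simp [hy]
    · intro h; exact absurd (mem_univ _) h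
  · intro x _ hx; simp [hx]
  · intro h; exact absurd (mem_univ _) h

/-- ★ Bridge: `Bcoef` of an integer-valued slot is the integer mirror `BZ`. [this work] -/
theorem Bcoef_eq_BZ (π : Fin k → ℕ) (fZ : Pt k → ℤ) (e e' : Pt k) :
    Bcoef π (fun x => (fZ x : ℝ)) e e' = (BZ π fZ e e' : ℝ) := by
  unfold Bcoef BZ
  have split : ∀ σ : Pt k × Pt k × Pt k, arrInd π σ.1 σ.2.1 σ.2.2 *
      ((fZ σ.1 : ℝ) * (if σ.2.1 = e ∧ σ.2.2 = e' then 1 else 0) - (fZ σ.2.1 : ℝ) * (if σ.1 = e ∧ σ.2.1 = e' then 1 else 0)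
        - (fZ σ.2.1 : ℝ) * (if σ.2.1 = e ∧ σ.1 = e' then 1 else 0)) =
      arrInd π σ.1 σ.2.1 σ.2.2 * ((fZ σ.1 : ℝ) * (if σ.2.1 = e ∧ σ.2.2 = e' then 1 else 0))
      - arrInd π σ.1 σ.2.1 σ.2.2 * ((fun a b _ => (fZ b : ℝ)) σ.1 σ.2.1 σ.2.2 * (if σ.1 = e ∧ σ.2.1 = e' then 1 else 0))
      - arrInd π σ.1 σ.2.1 σ.2.2 * ((fun a b _ => (fZ b : ℝ)) σ.1 σ.2.1 σ.2.2 * (if σ.1 = e' ∧ σ.2.1 = e then 1 else 0)) := by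
    intro σ
    have : (if σ.2.1 = e ∧ σ.1 = e' then (1:ℝ) else 0) = (if σ.1 = e' ∧ σ.2.1 = e then 1 else 0) := by
      congr 1; exact propext and_comm
    rw [this]; ring
  simp only [split, sum_sub_distrib]
  have hA := sum_arrInd_pin23 π (fun x => (fZ x : ℝ)) e e'
  have hB := sum_arrInd_pin12 π (fun _ b _ => (fZ b : ℝ)) e e'
  have hC := sum_arrInd_pin12 π (fun _ b _ => (fZ b : ℝ)) e' e
  rw [hA, hB, hC, zOf_comm π e' e]
  have hsw : IsArr π e' e (zOf π e e') ↔ IsArr π e e' (zOf π e e') := isArr_swap12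
  by_cases h1 : IsArr π e e' (zOf π e e')
  · have h1' := hsw.2 h1
    simp only [h1, h1', if_true]
    push_cast; split_ifs <;> ring
  · have h1' : ¬ IsArr π e' e (zOf π e e') := fun h => h1 (hsw.1 h)
    simp only [h1, h1', if_false]
    push_cast; split_ifs <;> ring

/-- ★ Bridge: `cKcoef` of an integer-valued slot is the integer mirror `cKZ`. [this work] -/
theorem cKcoef_eq_cKZ (π : Fin k → ℕ) (fZ : Pt k → ℤ) (e : Pt k) :
    cKcoef π (fun x => (fZ x : ℝ)) e = (cKZ π fZ e : ℝ) := by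
  unfold cKcoef cKZ
  push_cast
  rw [sum_sub_distrib]
  have split : ∀ σ : Pt k × Pt k × Pt k, arrInd π σ.1 σ.2.1 σ.2.2 *
      (2 * (fZ σ.1 : ℝ) * (if σ.1 = e then 1 else 0) - (fZ σ.1 : ℝ) * (if σ.2.1 = e then 1 else 0)) =
      arrInd π σ.1 σ.2.1 σ.2.2 * (2 * (fZ σ.1 : ℝ) * (if σ.1 = e then 1 else 0))
      - arrInd π σ.1 σ.2.1 σ.2.2 * ((fZ σ.1 : ℝ) * (if σ.2.1 = e then 1 else 0)) := fun σ => by ring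
  simp only [split, sum_sub_distrib]
  congr 1
  · -- first copy pinned at `e`; collapse the third copy, sum over the second
    rw [Fintype.sum_prod_type, Finset.sum_eq_single e]
    · rw [Fintype.sum_prod_type]
      refine sum_congr rfl fun y _ => ?_
      rw [Finset.sum_eq_single (zOf π e y)]
      · simp only [arrInd, if_true, mul_one]; split_ifs <;> simp
      · intro z _ hz
        have : ¬ IsArr π e y z := fun h => hz (eq_zOf_of_isArr h)
        simp [arrInd, this]
      · intro h; exact absurd (mem_univ _) h
    · intro x _ hx; simp [hx]
    · intro h; exact absurd (mem_univ _) h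
  · -- second copy pinned at `e`; collapse the third copy, sum over the first
    rw [Fintype.sum_prod_type]
    refine sum_congr rfl fun x _ => ?_
    rw [Fintype.sum_prod_type, Finset.sum_eq_single e]
    · rw [Finset.sum_eq_single (zOf π x e)]
      · simp only [arrInd, if_true, mul_one]; split_ifs <;> simp
      · intro z _ hz
        have : ¬ IsArr π x e z := fun h => hz (eq_zOf_of_isArr h)
        simp [arrInd, this]
      · intro h; exact absurd (mem_univ _) h
    · intro y _ hy; simp [hy]
    · intro h; exact absurd (mem_univ _) h


/-- Collapsing an arrangement sum in which copy 1 is pinned (sum over copy 2 remains). [this work] -/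
theorem sum_arrInd_pin1 (π : Fin k → ℕ) (g : Pt k → Pt k → ℝ) (e : Pt k) :
    ∑ σ : Pt k × Pt k × Pt k, arrInd π σ.1 σ.2.1 σ.2.2 * (g σ.1 σ.2.1 * (if σ.1 = e then 1 else 0)) =
      ∑ y : Pt k, if IsArr π e y (zOf π e y) then g e y else 0 := by
  rw [Fintype.sum_prod_type, Finset.sum_eq_single e]
  · rw [Fintype.sum_prod_type]
    refine sum_congr rfl fun y _ => ?_
    rw [Finset.sum_eq_single (zOf π e y)]
    · simp only [arrInd]; split_ifs <;> simp
    · intro z _ hz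
      have : ¬ IsArr π e y z := fun h => hz (eq_zOf_of_isArr h)
      simp [arrInd, this]
    · intro h; exact absurd (mem_univ _) h
  · intro x _ hx; simp [hx]
  · intro h; exact absurd (mem_univ _) h

/-- Collapsing an arrangement sum in which copy 2 is pinned (sum over copy 1 remains). [this work] -/
theorem sum_arrInd_pin2 (π : Fin k → ℕ) (g : Pt k → Pt k → ℝ) (e : Pt k) :
    ∑ σ : Pt k × Pt k × Pt k, arrInd π σ.1 σ.2.1 σ.2.2 * (g σ.1 σ.2.1 * (if σ.2.1 = e then 1 else 0)) =
      ∑ x : Pt k, if IsArr π x e (zOf π x e) then g x e else 0 := by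
  rw [Fintype.sum_prod_type]
  refine sum_congr rfl fun x _ => ?_
  rw [Fintype.sum_prod_type, Finset.sum_eq_single e]
  · rw [Finset.sum_eq_single (zOf π x e)]
    · simp only [arrInd]; split_ifs <;> simp
    · intro z _ hz
      have : ¬ IsArr π x e z := fun h => hz (eq_zOf_of_isArr h)
      simp [arrInd, this]
    · intro h; exact absurd (mem_univ _) h
  · intro y _ hy; simp [hy]
  · intro h; exact absurd (mem_univ _) h

/-- Integer mirror of `n₁(e)` = number of arrangements with first copy `e`. [this work] -/
def nArr1Z (π : Fin k → ℕ) (e : Pt k) : ℤ := ∑ y : Pt k, if IsArr π e y (zOf π e y) then 1 else 0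

/-- Bridge: `nArr1 = nArr1Z`. [this work] -/
theorem nArr1_eq_nArr1Z (π : Fin k → ℕ) (e : Pt k) : nArr1 π e = (nArr1Z π e : ℝ) := by
  unfold nArr1 nArr1Z
  have := sum_arrInd_pin1 π (fun _ _ => (1 : ℝ)) e
  simp only [one_mul] at this
  rw [this]; push_cast; rfl

end Summit.CriticalPhenomena.PercolationContinuityZ3.Theorems.SahiThreeCopy
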